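import Mathlib
import Summits.ResolutionOfSingularities.ResolutionOfSingularities.Theses.HomologicalConductor
import Summits.ResolutionOfSingularities.ResolutionOfSingularities.Theorems.HomologicalConductorNoZenoBirthDefs
import Summits.ResolutionOfSingularities.ResolutionOfSingularities.Theorems.HomologicalConductorSurfaceTerminationRQHDefs
import Summits.ResolutionOfSingularities.ResolutionOfSingularities.Theorems.HomologicalConductorPersistenceKC3LocalModelEquiv
import HarnessLib

/-!
# Kill test `SurfaceTermination` (stmt-16488) — (R-QH) is a special case of the item (certified link)

[OURS · cell res-hironaka · LADDER-RESOLUTION L ★L-G4 W4.4 · res-L0-w44-lead-1 g7] AI-written; weaker than expert review; NOT a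
statement of the manuscript under review (Hironaka 2017). Def-free, fact-free. The typed target `SurfaceTerminationQH`
(`…SurfaceTerminationRQHDefs`) is `SurfaceTermination` restricted to weighted-homogeneous presentations and their weight
valuation rings; this file certifies the restriction (so a refutation of (R-QH) refutes the item, and every decided instance
of (R-QH) is an instance of the item). Counted 0.
-/

namespace Summit.ResolutionOfSingularities.ResolutionOfSingularities.Theorems.SurfaceTermination.RQH

-- single-problem summit: the doubled namespace component `ResolutionOfSingularities` is forced by the layout
set_option linter.dupNamespace false

open Summit.ResolutionOfSingularities.ResolutionOfSingularities.Theses.HomologicalConductor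
open Summit.ResolutionOfSingularities.ResolutionOfSingularities.Theorems.NoZeno.Birth

/-- **CERTIFIED LINK: (R-QH) is a special case of the kill-test item.** `SurfaceTermination → SurfaceTerminationQH`
(the route binders are instantiated at `A := range (aeval g)`, finitely generated by construction and contained in `O`
because every generator has value `< 1` and `k ⊆ O` — tree lemma `KC3Upper.aeval_mem_valuationSubring`). So a refutation
of (R-QH) refutes `SurfaceTermination`, and every decided instance of (R-QH) is an instance of the item. [this work] -/
theorem surfaceTerminationQH_of_surfaceTermination (h : SurfaceTermination) : SurfaceTerminationQH := by
  intro p hp k K _ _ _ _ O n g w _hw hk hfr hdim _hhom _hval hg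
  have hA : (MvPolynomial.aeval (R := k) g).range.FG :=
    ⟨(Set.finite_range g).toFinset, by rw [Set.Finite.coe_toFinset, Algebra.adjoin_range_eq_range_aeval]⟩
  have hAO : (MvPolynomial.aeval (R := k) g).range.toSubring ≤ O.toSubring := by
    rintro a ⟨q, rfl⟩
    exact HomologicalConductor.KC3Upper.aeval_mem_valuationSubring g O hk hg q
  exact h p hp k K O _ hk hA hfr hAO hdim

end Summit.ResolutionOfSingularities.ResolutionOfSingularities.Theorems.SurfaceTermination.RQH
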